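import Mathlib

/-!
# Line `Sketch` for the crux `RobustYangMillsRG` (stmt-QuantumFields-14958) — stub
# `stub_uniformFromPointwise` (card `block-lattice-compactness`, soft half)

Crux: `Summit.QuantumFields.QCD.Theses.NestedDissectionSea.RobustYangMillsRG` (shared verbatim with
`HeavyThresholdYMBridge`), item stmt-QuantumFields-14958; skeleton `Cruxes/RobustYangMillsRG/Lines/Sketch.lean`
(lead `prover-line-stmt-QuantumFields-14958-0`).  The registered stub `stub_uniformFromPointwise`, closed:
an upper semicontinuous real function on a nonempty compact space that is pointwise strictly below `t`
is uniformly below some `t' < t` (it attains its maximum, Mathlib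
`UpperSemicontinuousOn.exists_isMaxOn`).  In the line this converts a POINTWISE certificate (finite-size
mixing influence below threshold at every limit Gibbs state of the compactified format) into the
crux's uniformities (card `block-lattice-compactness`, FINDINGS-r1-k1 A1).
-/

set_option autoImplicit false

namespace Summit.QuantumFields.QCD.Cruxes.RobustYangMillsRG.Sketch

/-- **Uniform-from-pointwise by compactness**: an upper semicontinuous real function on a nonempty
compact space that is pointwise strictly below `t` is uniformly below some `t' < t`. -/
def UniformFromPointwise : Prop :=
  ∀ (K : Type) [TopologicalSpace K] [CompactSpace K] [Nonempty K] (θ : K → ℝ) (t : ℝ),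
    UpperSemicontinuous θ → (∀ x, θ x < t) → ∃ t' < t, ∀ x, θ x ≤ t'

/-- **stub_uniformFromPointwise** — the registered stub, closed: the maximum of `θ` is attained
(`UpperSemicontinuousOn.exists_isMaxOn` on `Set.univ`) and serves as `t'`. -/
theorem stub_uniformFromPointwise : UniformFromPointwise := by
  intro K _ _ _ θ t hθ ht
  obtain ⟨a, -, ha⟩ := UpperSemicontinuousOn.exists_isMaxOn (f := θ) Set.univ_nonempty
    isCompact_univ (hθ.upperSemicontinuousOn Set.univ)
  exact ⟨θ a, ht a, fun x => ha (Set.mem_univ x)⟩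

end Summit.QuantumFields.QCD.Cruxes.RobustYangMillsRG.Sketch
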